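import Summits.BirchSwinnertonDyer.BirchSwinnertonDyer.Theses.PrintX10b
import Summits.BirchSwinnertonDyer.BirchSwinnertonDyer.Theorems.PrintX10bHowardContainmentAnyClassNumberX10bThm413Hyp
import Summits.BirchSwinnertonDyer.BirchSwinnertonDyer.Theorems.PrintX10bHowardContainmentLightFrameX10bEnvelope
import Summits.BirchSwinnertonDyer.BirchSwinnertonDyer.Theorems.PrintX9MuPartStabilizedWeakLetters
import Summits.BirchSwinnertonDyer.BirchSwinnertonDyer.Theorems.PrintX10bAssemblyLightTwinsX10b
import Summits.BirchSwinnertonDyer.BirchSwinnertonDyer.Theorems.PrintX10bTwoSidedLinkAnyClassNumberX10bPinnedOfPrint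
import Summits.BirchSwinnertonDyer.BirchSwinnertonDyer.Theorems.PrintX10bAnalyticMuZeroX10b
import Literature.NumberTheory.EllipticCurves.CastellaGrossiSkinner2025.HeegnerKolyvaginBoundAnyClassNumberProofs
import Literature.NumberTheory.EllipticCurves.HeegnerCharIdealEnvelopeProofs
import Literature.NumberTheory.EllipticCurves.HeegnerCharIdealEnvelopePowTransferProofs
import Literature.NumberTheory.EllipticCurves.IwasawaAlgebraPromotionProofs
import Literature.NumberTheory.EllipticCurves.IwasawaAlgebraMuPromotionProofs
import HarnessLib

/-!
# The deciding crux `PrintX10b.HowardContainmentLightFrameX10bPinnedOfPrint` (stmt-BirchSwinnertonDyer-27275, row 10)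
# from the COHERENT-PAIR μ-letter `HeegnerMuPartStabilized.MuPartStabilizedCoherentPair` (L∃, p630902) — CONDITIONAL
# CLOSER, plus the row-10 corner / leaf certificates from L∃ ⊕ the route's seven cite-only print binders

Cell `pub/bsd-print-x9`, LEAD `bsd-line-x10b-p2` (g4). THEOREMS ONLY (no definition, no named fact, no `sorry`);
`--supports stmt-BirchSwinnertonDyer-27275` (helper). The crux is NOT closed here; no summit statement is proved by this
seat; BSD is not proved by any of this. «beyond-print theorem»: no.

WHY (tribunal-w g9 FINDING MU-LETTER-∀C 11:40:42Z, μ-item LEAD x9-p1 g2 POSITION 11:53:02Z endorsing L∃): the shared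
μ-letter `MuPartStabilizedOfPrint` (p625984) quantifies `∀ (C : StabilizedHeegnerData …)`, i.e. over layerwise
Galois-INCOHERENT stabilised data as well, while every consumer — the row-10 closer p625072/p628126 included — uses the
inequality ONLY at the engine's coherent datum `C₀` of `exists_coherent_pair_envelope`, and the road meant to prove it
(Howard's `𝔮 = T^m + p` specialisation) runs on ONE principal system. The weaker letter L∃
(`MuPartStabilizedCoherentPair`): for every `(Dt, β, D, X)` THERE IS a coherent pair `(C, F)` on `(Dt, β)` with
`ℋ_∞(F) ≤ Λκ_∞(C)`, `g • Λκ_∞(C) ≤ ℋ_∞(F)` (`g ≠ 0`) and the μ-inequality AT THAT `C`. This file re-plumbs the row-10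
closer to L∃: the engine call inside `PrintX10bSharpMuStabilized.howardContainmentLightFrameX10bPinnedOfPrint_of_promotion`
is replaced by L∃'s export list; everything else (MZ26 Cor. 4.6 at `3 ∤ h_K`; CGLS 4.1.1 ⇒ `𝔖/Λκ_C` torsion; CGS 6.5.2 ⇒
`(3^m)·I(Λκ_C)² ⊆ char(𝒳_tors)`; x10b-p1's promotion p613811; `I(ℋ_F) ≤ I(Λκ_C)`) is unchanged. The extra binders of L∃
are discharged on the X10b light frame: `Thm413Hypotheses` (`X10.thm413Hypotheses_of_classX10`), irr_ℚ (`ClassX10.irr`),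
MZ26 scalars (`ClassX10.hasPadicScalarImage_of_not_surj`, Lombardo–Tronto 3.12), `3 ∤ N` (`ClassX10.not_dvd_conductorNorm`),
`K_k ⊆ K[p^{k+1}]` (route binder `AnticyclotomicTowerSharp`), `[K[p] : K[1]] = p − 1`
(`card_ringClassGalOver_prime_one_of_frame`). So whoever proves L∃ closes 27275 (and the X9 twin 27077) in one line, and
L∃ ⟸ `MuPartStabilizedOfPrint` is `muPartStabilizedCoherentPair_of_print` (p630902): this closer is WEAKER-INPUT than
p628126's.

References: Mastella–Zerman, arXiv:2505.08710, Cor. 4.6; Castella–Grossi–Lee–Skinner, Invent. Math. 227 (2022), Thm.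
4.1.1, Rem. 4.1.4; Castella–Grossi–Skinner, Math. Ann. 393 (2025), Thm. 6.5.2; Howard, Compositio 140 (2004), Thm.
2.2.10, §3.3, Thm. 3.3.7; Washington, GTM 83, §13.2; Lombardo–Tronto 2022, Prop. 3.12.
-/

set_option linter.dupNamespace false
set_option autoImplicit false

noncomputable section

open scoped Classical Pointwise
open Literature Literature.NumberTheory.EllipticCurves WeierstrassCurve
  Literature.NumberTheory.EllipticCurves.ModularForms
  Literature.NumberTheory.EllipticCurves.CastellaGrossiLeeSkinner2022
open Literature.NumberTheory.EllipticCurves.Rank1Residual (ClassX10 Surj)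
open Summit.BirchSwinnertonDyer.BirchSwinnertonDyer.Theses.PrintX10b
  (MastellaZermanHowardDivisibility CGLSHeegnerClassNonvanishing
    CGSHowardDivisibilityPLocalized AnticyclotomicTowerSharp HowardContainmentLightFrameX10bPinned
    HowardContainmentLightFrameX10bPinnedOfPrint PinnedTransferPrintFacts HeegnerPrintFactsX10b PrintFactsX10b closes)
open Summit.BirchSwinnertonDyer.BirchSwinnertonDyer.Theorems.HeegnerMuPartStabilized (MuPartStabilizedCoherentPair)

namespace Summit.BirchSwinnertonDyer.BirchSwinnertonDyer.Theorems.PrintX10bSharpMuCoherentPair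

/-! ## §1 The crux from the coherent-pair letter -/

/-- **CLOSER: `MuPartStabilizedCoherentPair → HowardContainmentLightFrameX10bPinnedOfPrint`** — the row-10 deciding crux
BY NAME from the coherent-pair μ-letter L∃. `jbar := IsAlgClosed.lift` along `ιC`; `3 ∤ h_K`: MZ26 Cor. 4.6
(`X10.heegnerContainmentPinned_of_cor46_of_not_surj`, p607508); `3 ∣ h_K`: data `D`, `X` exist, L∃ at
`(Dt, H.β, D, X)` exports a coherent pair `(C, F)` on `Dt` with `ℋ_F ≤ Λκ_C`, `g • Λκ_C ≤ ℋ_F` (`g ≠ 0`) and the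
μ-inequality at `C`; CGLS Thm. 4.1.1 (`hNV`) at `(D, C)` ⇒ `𝔖/Λκ_C` torsion; CGS Thm. 6.5.2 (`hCGS`) at `(D, C, X)` ⇒
`𝔖`, `𝒳` f.g. and `(p^m)·I(Λκ_C)² ⊆ char(𝒳_tors)`; promotion
(`IwasawaAlgebra.sq_charIdeal_le_charIdeal_of_span_p_pow_mul_le_of_lengthAt_le_two_mul`, p613811) ⇒
`I(Λκ_C)² ⊆ char(𝒳_tors)`; `I(ℋ_F) ≤ I(Λκ_C)` ⇒ `I(ℋ_F)² ⊆ char(𝒳_tors)` with `F.Dt = Dt`.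
[cite: CastellaGrossiLeeSkinner2022, Thm. 4.1.1, Rem. 4.1.4] [cite: CastellaGrossiSkinner2025, Thm. 6.5.2]
[cite: MastellaZerman2026, Cor. 4.6] [cite: LombardoTronto2022, Prop. 3.12] [cite: Washington1997, §13.2] -/
theorem howardContainmentLightFrameX10bPinnedOfPrint_of_muPartStabilizedCoherentPair
    (h : MuPartStabilizedCoherentPair) : HowardContainmentLightFrameX10bPinnedOfPrint := by
  intro hMZ hNV hCGS hTw W _ _ p _ _ K _ _ hX hns hcm hK hodd h3 hHN hHp hirr κ hκ γ hγ Dt H ιC hc hrk hfin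
  letI : Algebra K ℂ := ιC.toAlgebra
  let jbar : AlgebraicClosure K →+* ℂ :=
    (IsAlgClosed.lift (R := K) (M := ℂ) (S := AlgebraicClosure K)).toRingHom
  have hp : p.Prime := Fact.out
  by_cases hhK : p ∣ NumberField.classNumber K
  · obtain ⟨D⟩ := LambdaAdicSelmerDataExists.nonempty_lambdaAdicSelmerData (W.baseChange K) p κ hγ
    obtain ⟨X⟩ := (W.baseChange K).nonempty_selmerDualData_holds κ γ hγ
    have hyp := Summit.BirchSwinnertonDyer.BirchSwinnertonDyer.Rank1Residual.X10.thm413Hypotheses_of_classX10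
      hX hK h3 hHN hHp hodd hκ hγ
    have hirrQ : W.HasIrreducibleModPGaloisRep p := by
      obtain ⟨rfl, -⟩ := id hX
      exact hX.irr
    have hTw1 : ∀ k : ℕ, ringClassSubgroup K (p ^ (k + 1)) jbar ≤ κ.layerSubgroup k :=
      fun k ↦ hTw K p (hp.odd_of_ne_two hX.ne_two) hK κ hκ jbar k
    -- L∃ at `(Dt, H.β, D, X)`: the coherent pair `(C, F)` on `Dt`, the envelope, and the μ-inequality AT THAT `C`
    obtain ⟨C, F, -, hFDt, -, -, hle, ⟨g, hg, hrev⟩, hμC⟩ :=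
      h (W.conductorNorm ℤ) W K p κ γ jbar hyp hcm hirrQ hirr
        (Rank1Residual.ClassX10.hasPadicScalarImage_of_not_surj hX hns) hHp hhK hX.not_dvd_conductorNorm hTw1
        (card_ringClassGalOver_prime_one_of_frame hK hodd h3 hp hHp jbar) Dt H.β H.dvd_sq_sub D X
    -- CGLS Thm. 4.1.1 + Cornut–Vatsal BY NAME at `(D, C)`: `𝔖` torsion-free, `𝔖/Λκ_C` torsion
    have h411 : CastellaGrossiLeeSkinner2022.thm411_torsionFree_heegnerClass_ne_bot_quotient_isTorsion.{0} := hNV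
    obtain ⟨hfree, -, htorC⟩ := h411 (W.conductorNorm ℤ) W K p κ γ jbar hyp D C
    haveI := hfree
    -- CGS Thm. 6.5.2 BY NAME at `(D, C, X)`: finiteness of `𝔖`, `𝒳` and the p-localized bound in C-currency
    have h652 : CastellaGrossiSkinner2025.thm652_stabilized_rankOne_charIdeal_torsion_dvd_pLocalized.{0} := hCGS
    obtain ⟨⟨hfinS, -⟩, hfinX, -⟩ := h652 (W.conductorNorm ℤ) W K p κ γ jbar hyp D C X
    haveI := hfinS
    haveI := hfinX
    obtain ⟨m, hm⟩ := CastellaGrossiSkinner2025.span_pow_mul_sq_le_charIdeal_torsion_of_thm652_stabilized h652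
      hyp D C X
    -- the μ-inequality at `C` promotes the p-localized bound (x10b-p1's promotion, p613811)
    haveI : IsNoetherian (IwasawaAlgebra p) X.X := isNoetherian_of_isNoetherianRing_of_finite _ _
    haveI : Module.Finite (IwasawaAlgebra p) (Submodule.torsion (IwasawaAlgebra p) X.X) := inferInstance
    haveI : Module.Finite (IwasawaAlgebra p) (D.S ⧸ stabilizedHeegnerModule D C) := inferInstance
    have hsqC : stabilizedHeegnerCharIdeal D C ^ 2 ≤
        Module.charIdeal (IwasawaAlgebra p) (Submodule.torsion (IwasawaAlgebra p) X.X) := by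
      rw [stabilizedHeegnerCharIdeal_def] at hm ⊢
      exact IwasawaAlgebra.sq_charIdeal_le_charIdeal_of_span_p_pow_mul_le_of_lengthAt_le_two_mul
        (Submodule.torsion_isTorsion (R := IwasawaAlgebra p) (M := X.X)) htorC (hμC hfinS hfinX htorC) hm
    -- torsion of `𝔖/ℋ_F` from the reverse inclusion, then `I(ℋ_F) ≤ I(Λκ_C)` from the sharp forward inclusion
    have htor : Module.IsTorsion (IwasawaAlgebra p) (D.S ⧸ heegnerModule D F) :=
      isTorsion_quotient_heegnerModule_of_smul_stabilizedHeegnerModule_le D F C hg hrev htorC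
    have hIF : heegnerCharIdeal D F ≤ stabilizedHeegnerCharIdeal D C :=
      heegnerCharIdeal_le_stabilizedHeegnerCharIdeal_of_le D F C htor hle
    exact ⟨jbar, D, F, X, hFDt, (Ideal.pow_right_mono hIF 2).trans hsqC⟩
  · have h46 : MastellaZerman2026.cor46_howardDivisibility_of_scalarImage.{0} := hMZ
    obtain ⟨D, F, X, hFD, -, hle⟩ :=
      Summit.BirchSwinnertonDyer.BirchSwinnertonDyer.Rank1Residual.X10.heegnerContainmentPinned_of_cor46_of_not_surj
        h46 hX hns hcm hK h3 (hK.discr_lt_neg_four_of_odd hodd h3).ne hHN hHp hhK κ hκ γ hγ Dt H jbar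
    exact ⟨jbar, D, F, X, hFD, hle⟩

/-- **The LIGHT A₃ containment itself from the four print binders and L∃** (curried form for consumers of
`HowardContainmentLightFrameX10bPinned`, e.g. the closed assembly `AssemblyLightTwinsX10b`).
[cite: CastellaGrossiSkinner2025, Thm. 6.5.2] [cite: MastellaZerman2026, Cor. 4.6] -/
theorem howardContainmentLightFrameX10bPinned_of_print_of_muPartStabilizedCoherentPair
    (h : MuPartStabilizedCoherentPair) (hMZ : MastellaZermanHowardDivisibility) (hNV : CGLSHeegnerClassNonvanishing)
    (hCGS : CGSHowardDivisibilityPLocalized) (hTw : AnticyclotomicTowerSharp) :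
    HowardContainmentLightFrameX10bPinned :=
  howardContainmentLightFrameX10bPinnedOfPrint_of_muPartStabilizedCoherentPair h hMZ hNV hCGS hTw

/-! ## §2 Row-10 residual certificate in the L∃ currency -/

/-- **Row-10 corner `WAllCornerX10b` ⟸ seven cite-only print binders ⊕ L∃** (the route's `closes` with its three closed
doors supplied BY NAME — `assemblyLightTwinsX10b_proof` p622251, `twoSidedLinkAnyClassNumberX10bPinnedOfPrint_holds`
p613989, `AnalyticMuZeroX10b_of` — and the deciding crux supplied by the §1 closer).
[cite: CastellaGrossiLeeSkinner2022, Conj. 1 (the μ-part) and Thm. 4.1.1] [cite: CastellaGrossiSkinner2025, Thm. 6.5.2]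
[cite: MastellaZerman2026, Cor. 4.6] -/
theorem wallCornerX10b_of_coherentPair_of_printBinders (h : MuPartStabilizedCoherentPair)
    (hMZ : MastellaZermanHowardDivisibility) (hNV : CGLSHeegnerClassNonvanishing)
    (hCGS : CGSHowardDivisibilityPLocalized) (hTw : AnticyclotomicTowerSharp) (hPT : PinnedTransferPrintFacts)
    (hHP : HeegnerPrintFactsX10b) (hP : PrintFactsX10b) :
    Summit.BirchSwinnertonDyer.WAllCornerX10b :=
  -- buildfix (bf3-g30, class (i) drift): the route's `closes` was re-keyed (2026-08-28, binders `HowardDVRKolyvaginBound` /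
  -- `CGLSHeegnerKolyvaginSystem` / `MuInequalityCoherentPairOfPrint` / `…PinnedOfPrintOfPrintMu`); this closer keeps its accepted
  -- statement and inlines the pre-edit body of `closes` (= `wallCornerX10b_of_bsdpOnClassX10b` ∘ the light assembly), with the
  -- same three closed doors BY NAME and the §1 containment, exactly as `bsdpOnClassX10b_of_coherentPair_of_printBinders` below.
  Summit.BirchSwinnertonDyer.Rank1Residual.WAll.wallCornerX10b_of_bsdpOnClassX10b
    (Summit.BirchSwinnertonDyer.BirchSwinnertonDyer.Theorems.PrintX10bAssemblyLightTwinsX10b.assemblyLightTwinsX10b_proof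
      (howardContainmentLightFrameX10bPinned_of_print_of_muPartStabilizedCoherentPair h hMZ hNV hCGS hTw)
      (Summit.BirchSwinnertonDyer.BirchSwinnertonDyer.Theorems.PrintX10bPinned.twoSidedLinkAnyClassNumberX10bPinnedOfPrint_holds
        hPT hHP)
      hHP Summit.BirchSwinnertonDyer.BirchSwinnertonDyer.Cruxes.AnalyticMuZeroX10b.TheoremB.AnalyticMuZeroX10b_of hP)

/-- **Partition leaf `X10.BSDpOnClassX10b` ⟸ seven cite-only print binders ⊕ L∃** (through the LIGHT assembly
`AssemblyLightTwinsX10b`, p622251, fed with the light A₃ containment from the §1 closer, the B₃ door p613989 and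
analytic `μ = 0` on class X10b).
[cite: JetchevSkinnerWan2017, Thm. 3.3.1] [cite: YanZhu2024MainConjNonCM, Thm. 5.7 (1), Thm. 5.9]
[cite: CastellaGrossiLeeSkinner2022, Conj. 1 (the μ-part)] -/
theorem bsdpOnClassX10b_of_coherentPair_of_printBinders (h : MuPartStabilizedCoherentPair)
    (hMZ : MastellaZermanHowardDivisibility) (hNV : CGLSHeegnerClassNonvanishing)
    (hCGS : CGSHowardDivisibilityPLocalized) (hTw : AnticyclotomicTowerSharp) (hPT : PinnedTransferPrintFacts)
    (hHP : HeegnerPrintFactsX10b) (hP : PrintFactsX10b) :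
    Summit.BirchSwinnertonDyer.Rank1Residual.X10.BSDpOnClassX10b :=
  Summit.BirchSwinnertonDyer.BirchSwinnertonDyer.Theorems.PrintX10bAssemblyLightTwinsX10b.assemblyLightTwinsX10b_proof
    (howardContainmentLightFrameX10bPinned_of_print_of_muPartStabilizedCoherentPair h hMZ hNV hCGS hTw)
    (Summit.BirchSwinnertonDyer.BirchSwinnertonDyer.Theorems.PrintX10bPinned.twoSidedLinkAnyClassNumberX10bPinnedOfPrint_holds
      hPT hHP)
    hHP Summit.BirchSwinnertonDyer.BirchSwinnertonDyer.Cruxes.AnalyticMuZeroX10b.TheoremB.AnalyticMuZeroX10b_of hP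

end Summit.BirchSwinnertonDyer.BirchSwinnertonDyer.Theorems.PrintX10bSharpMuCoherentPair

end
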